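import Literature.MathematicalPhysics.QuantumFieldTheory.Balaban1983to89.Beta.PlaquetteVertex

/-!
# The `(2,1)`-jet of the Wilson plaquette sum AT A PURE-GAUGE BACKGROUND: the background-gauge Ward identity `jet21_grad`

HONEST FRAMING (cell charter, verbatim): «discharging `BetaPertH` makes Bałaban's UV stability UNCONDITIONAL — a real
constructive-QFT result; it is NOT the continuum limit and NOT the Clay problem.»  DERIVED cell leaf (pub-balaban β sub-cell, D1
formalisation swarm seat `b2b-balaban-beta-d1-formalise-leaf-05`, gen 2; leaf (W-LS0-E) «the Wilson Ward law» of an1-g25's hW skeleton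
`HOME/b2b-balaban-beta-an1-g25/SKELETON-D1-hW.v1.md` §2 (W-LS)_0, stage 1 of 3 = RING LEVEL): pure non-commutative word algebra and finite
lattice bookkeeping over an3's `WilsonVertex` / `PlaquetteVertex` (Literature, [folklore] kernel algebra); nothing cited, no `[cite:]` tag,
no `def … : Prop`; it instantiates NO binder of the β-function wall.  NOT `BetaPertH`, NOT continuum, NOT Clay.
HONEST DEPENDENCY (cell records, verbatim): «continuum YM on T⁴ ⇐ BetaPertH ∧ nine spine estimates (0/9 proved); BetaPertH ⇐ (D1) ∧
(D4) ∧ CAP+tail; G-an2-4 gates asym, D1 and NE2/3/4.»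
ABSOLUTE RULE (cell charter, verbatim): «No internally-minted statement may enter as a cited fact. Every hypothesis is either
kernel-proved in this package or a verbatim quotation of a PUBLISHED theorem with page reference. The manuscript(s) under audit are
NOT citable for their own disputed steps — they are the thing under adjudication; programme-internal (2001/route/tribunal) claims are
never citable.»

WHAT IS HERE ([folklore]; `τ` any `𝕜`-linear TRACIAL functional, `𝔸` any normed `𝕜`-algebra, `Λ` any finite abelian lattice with frame
`e : D → Λ`; the twin of an3's `WilsonJetReflection` for the DIVERGENCE instead of the reflection).
* §0 OBJECTS (no finiteness): `grad e λ x δ := λ(x + e_δ) − λ x` — the PURE-GAUGE background generated by a site field `λ : Λ → M`;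
  `adj λ W x k := λ x · W_k(x) − W_k(x) · λ x` — the infinitesimal conjugation of a bond field at each bond's base site; `lcurl_grad`
  (the curl of a gradient vanishes).
* §1 RING LEVEL: `twistW_grad` (an3's transport sum `PlaquetteVertex.twistW` at a gradient background is the curl of the conjugated
  fluctuation minus a base-site commutator), `trace_mul_br_self` (cyclicity kills `τ(Z·[λ, Z])`), and
  **`jet21_grad : jet21 𝕜 τ e W (grad e λ) = Σ_x Σ_μ Σ_ν τ((lcurl W)_{μν}(x) · (lcurl (adj λ W))_{μν}(x))`** — the summed `(2,1)`-jet
  (`PlaquetteVertex.jet21`, product chart `U_b = e^{W_b}e^{B_b}`, all ordered direction pairs) read at a pure gauge IS the polarised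
  `(2,0)`-jet (`PlaquetteVertex.jet20_eq`: `jet20 = ½ Σ τ((lcurl W)²)`) in the direction `adj λ W`.  Three lines over an3's normal form
  `PlaquetteVertex.jet21_eq`; no Baker–Campbell–Hausdorff, no analysis.  PROVENANCE of the shape (NOT used in any proof): `τ U(∂p)` is
  invariant under `U_b ↦ g(b₋) U_b g(b₊)⁻¹`; at `B = 0`, `g = e^{tλ}` moves `B` by `−t·grad λ + O(t²)` and `W` by `t·adj λ W + O(t²)`;
  the `(W², t¹)` coefficient of the invariance is `jet21_grad`.
(The linearity of `jet21` in the background and its decomposition over one-bond letters are an3's `PlaquetteBackground.jet21_add_bg` /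
`jet21_sum_bg` / `background_eq_sum_bondLetter` / `actionJet21_eq_wilsonVertexOp`, used BY NAME in the sequel.)  Sequels:
`WilsonStencilDivergence` (coordinates, colour stripping ⇒ the finite-lattice law of the antisymmetrised colourless stencil),
`WilsonDivergenceContact` (transfer to `ℤ^(d+1)`: the law for an2's `StepJetData.wilsonA` in `KernelWard.divV` / `ChartConjugation.conjV` form).
-/

namespace Summit.QuantumFields.BalabanUV.Beta.WilsonJetDivergence

open Finset
open scoped BigOperators
open Literature.MathematicalPhysics.QuantumFieldTheory.Balaban1983to89.Beta.SpinTable (br)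
open Literature.MathematicalPhysics.QuantumFieldTheory.Balaban1983to89.Beta.PlaquetteVertex

/-! ## §0 The objects (no finiteness of the lattice) -/

section Defs

/-- [folklore] THE PURE-GAUGE BACKGROUND generated by a site field `λ`: `(grad e λ)_δ(x) = λ(x + e_δ) − λ x`.  A definition asserting
nothing. -/
def grad {Λ : Type*} [AddCommGroup Λ] {D : Type*} {M : Type*} [AddCommGroup M] (e : D → Λ) (lam : Λ → M) : Λ → D → M :=
  fun x δ => lam (x + e δ) - lam x

/-- [folklore] THE INFINITESIMAL CONJUGATION of a bond field by the site field `λ` at each bond's base site: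
`(adj λ W)_k(x) = λ x · W_k(x) − W_k(x) · λ x`.  A definition asserting nothing. -/
def adj {Λ : Type*} {D : Type*} {𝔸 : Type*} [Ring 𝔸] (lam : Λ → 𝔸) (W : Λ → D → 𝔸) : Λ → D → 𝔸 :=
  fun x k => lam x * W x k - W x k * lam x

/-- [folklore] entries of `grad`. -/
@[simp] theorem grad_apply {Λ : Type*} [AddCommGroup Λ] {D : Type*} {M : Type*} [AddCommGroup M] (e : D → Λ) (lam : Λ → M) (x : Λ)
    (δ : D) : grad e lam x δ = lam (x + e δ) - lam x := rfl

/-- [folklore] entries of `adj`. -/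
@[simp] theorem adj_apply {Λ : Type*} {D : Type*} {𝔸 : Type*} [Ring 𝔸] (lam : Λ → 𝔸) (W : Λ → D → 𝔸) (x : Λ) (k : D) :
    adj lam W x k = lam x * W x k - W x k * lam x := rfl

/-- [folklore] **THE CURL OF A GRADIENT VANISHES** (per plaquette). -/
theorem lcurl_grad {Λ : Type*} [AddCommGroup Λ] {D : Type*} {M : Type*} [AddCommGroup M] (e : D → Λ) (lam : Λ → M) (x : Λ)
    (μ ν : D) : lcurl e (grad e lam) x μ ν = 0 := by
  have h : x + e ν + e μ = x + e μ + e ν := add_right_comm _ _ _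
  simp only [lcurl, grad, h]
  abel

end Defs

/-! ## §1 Ring level: the `(2,1)`-jet at a pure-gauge background -/

section Ring

variable (𝕜 : Type*) [RCLike 𝕜] {𝔸 : Type*} [NormedRing 𝔸] [NormedAlgebra 𝕜 𝔸]
variable {V : Type*} [AddCommGroup V] [Module 𝕜 V]
variable {Λ : Type*} [Fintype Λ] [AddCommGroup Λ] {D : Type*} [Fintype D]

omit [Fintype Λ] [Fintype D] [NormedAlgebra 𝕜 𝔸] in
/-- [folklore] **THE TRANSPORT SUM AT A GRADIENT BACKGROUND**: `twistW e W (grad e λ) = lcurl (adj λ W) − [λ x, lcurl W]` per plaquette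
(the accumulated backgrounds telescope to `λ(corner) − λ(x)`). -/
theorem twistW_grad (e : D → Λ) (W : Λ → D → 𝔸) (lam : Λ → 𝔸) (x : Λ) (μ ν : D) :
    twistW e W (grad e lam) x μ ν = lcurl e (adj lam W) x μ ν - br (lam x) (lcurl e W x μ ν) := by
  have h : x + e ν + e μ = x + e μ + e ν := add_right_comm _ _ _
  simp only [twistW, lcurl, grad, adj, br, h]
  noncomm_ring

omit [Fintype Λ] [Fintype D] in
/-- [folklore] cyclicity kills `τ(Z · [λ, Z])`. -/
theorem trace_mul_br_self (τ : 𝔸 →ₗ[𝕜] V) (hτ : ∀ a b : 𝔸, τ (a * b) = τ (b * a)) (lam Z : 𝔸) :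
    τ (Z * br lam Z) = 0 := by
  rw [br, mul_sub, map_sub, ← mul_assoc, hτ (Z * lam) Z, sub_self]

/-- [folklore] **THE `(2,1)`-JET AT A PURE-GAUGE BACKGROUND IS THE POLARISED `(2,0)`-JET IN THE CONJUGATION DIRECTION**:
`jet21 𝕜 τ e W (grad e λ) = Σ_x Σ_μ Σ_ν τ((lcurl W)_{μν}(x) · (lcurl (adj λ W))_{μν}(x))` for every tracial `τ` — the background-gauge
Ward identity of the Wilson plaquette jets at order `(W², B¹ → B⁰)`, from an3's normal form `jet21_eq`. -/
theorem jet21_grad (τ : 𝔸 →ₗ[𝕜] V) (hτ : ∀ a b : 𝔸, τ (a * b) = τ (b * a)) (e : D → Λ) (W : Λ → D → 𝔸) (lam : Λ → 𝔸) :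
    jet21 𝕜 τ e W (grad e lam) = ∑ x, ∑ μ, ∑ ν, τ (lcurl e W x μ ν * lcurl e (adj lam W) x μ ν) := by
  rw [jet21_eq 𝕜 τ hτ]
  refine Finset.sum_congr rfl fun x _ => Finset.sum_congr rfl fun μ _ => Finset.sum_congr rfl fun ν _ => ?_
  rw [lcurl_grad, zero_mul, map_zero, smul_zero, zero_add, twistW_grad, mul_sub, map_sub, trace_mul_br_self 𝕜 τ hτ, sub_zero]

end Ring

end Summit.QuantumFields.BalabanUV.Beta.WilsonJetDivergence
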